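import Mathlib.Combinatorics.HalesJewett
import Mathlib.Order.Filter.Ultrafilter.Basic
import Mathlib.Algebra.Order.BigOperators.Group.Multiset
import Mathlib.Algebra.BigOperators.Intervals
import Mathlib.Data.Fintype.Pigeonhole
import Mathlib.Data.Fintype.BigOperators
import Mathlib.Algebra.Group.Pi.Lemmas
import Mathlib.Algebra.Group.Action.Defs
import Mathlib.Algebra.Order.BigOperators.Group.Finset
import Mathlib.Tactic.Ring
import Mathlib.Tactic.Linarith
import Mathlib.Tactic.Positivity
import Mathlib.Tactic.NormNum
import HarnessLib

/-!
# Van der Waerden's theorem and cadences (Lothaire 1997, Chapter 3)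

A transcription of the statements of Chapter 3 ("van der Waerden's theorem", by J. E. Pin) of
M. Lothaire, *Combinatorics on Words* (Cambridge Mathematical Library, 1997), with proofs:

* §3.1 — **Theorem 3.1.3** (van der Waerden: for all `k, l` there is `N(k, l)` such that every
  partition of `{0, …, N(k, l)}` into `k` classes has a class containing an arithmetic progression
  of length `l`), **Proposition 3.1.2** (if `ℕ` is partitioned into `k` classes, one class contains
  arbitrarily long arithmetic progressions) and the book's proof (p. 39) that 3.1.2 implies 3.1.3 —
  a compactness argument, run here along a non-principal ultrafilter on `ℕ` instead of the
  convergent subsequence of the text (the limit colouring `χ` of the text is the ultralimit of the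
  colourings `χ_n`); 3.1.3 ⇒ 3.1.2 "clearly".
* §3.2 — **Theorem 3.2.1** (Grünwald, also known as Gallai–Witt): for a finite `S ⊆ ℕ^d` and
  every `k`-colouring of `ℕ^d` there are `a > 0` and `v` with `a S + v` monochromatic, `a` and the
  coordinates of `v` being bounded by a function of `S` and `k` only.  PROOF ROUTE: we do NOT
  transcribe Anderson's combinatorial induction `A(S)`, `C(p)` of pp. 40–41; the theorem is derived
  (for any additive commutative monoid in place of `ℕ^d`) from Mathlib's Hales–Jewett theorem
  `Combinatorics.Line.exists_mono_in_high_dimension`, exactly as Mathlib derives its (non-uniform)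
  `Combinatorics.exists_mono_homothetic_copy`; the uniform bound comes for free because the
  Hales–Jewett dimension does not depend on the colouring.  (The book's Notes, p. 49, place the
  text's proof in the Witt / Graham–Rothschild lineage.)
* §3.3 — cadences (Gardelle–Guilbaud): `T = {t₁ < ⋯ < tₙ}` is a *cadence* of the word
  `u = a₁ ⋯ a_r` if `0 < t₁`, `tₙ ≤ r` and `a_{t₁} = ⋯ = a_{tₙ}`; a cadence *of type `S`* is one of
  the form `α S + β` with `α, β > 0`; an *arithmetic cadence* (of order `n`, common difference
  `α`) is a cadence of type `{0, …, n-1}`.  **Proposition 3.3.1**, **Proposition 3.3.2** and the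
  book's two-line proof of their equivalence; the examples of p. 42 checked by `decide`
  (see `abbabbaab_cadence` for a remark on the printed order of the first example).
* §3.5 — the Erdős–Rado lower bound **(3.5.1)** `N(k, l) ≥ (2(l-1)k^{l-1})^{1/2}` with the
  counting proof of p. 47 (the count of progressions is bounded by an explicit injection into pairs
  instead of the text's closed-form sum), the table entry `N(2, 3) = 9` of p. 46 in cadence form
  (a kernel-checked search over the `2⁹` binary words of length `9`, plus the example `abbaabba`),
  and **Problem 3.5.1** (geometric progressions).

Conventions.  Positions in a word `u : List α` are `1, …, |u|` as in the text (`u[t-1]` in Lean's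
0-indexed access).  A "partition of `E` into `k` classes" is a colouring `c : E → κ` with `κ` a
finite type (`Fintype.card κ = k`); an arithmetic progression of length `l` inside a class is
`a, a + d, …, a + (l-1)d` with `d > 0` and constant colour, written `∀ i < l, c (a + i*d) = c a`
(the shape used by `Literature.Combinatorics.Additive.SzemerediTheorem`).  The finitary form
3.1.3 of van der Waerden's theorem also follows from the tree's (much deeper) Szemerédi /
density-Hales–Jewett files; this file imports Mathlib only.

NOT transcribed: §3.2's proof (see above), §3.4 (the Fürstenberg–Weiss topological proof),
the other entries of the numerical table and the bounds (3.5.2)–(3.5.13) of §3.5,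
Problems 3.1.1–3.1.2, 3.3.1–3.3.2, 3.5.2.
-/

open Finset

namespace Literature.Combinatorics.Words

/-! ### §3.2 — Theorem 3.2.1 from the Hales–Jewett theorem (uniform form) -/

section Uniform

variable {M : Type*} [AddCommMonoid M]

/-- The sums of at most `n` elements of `S` (with repetition): the translation parts `v` of the
homothetic copies `a S + v` produced by the Hales–Jewett argument lie in this set, which is what
bounds them "by a function of `S` and `k` only" (Theorem 3.2.1, second sentence).
[cite: Lothaire1997, Theorem 3.2.1] -/
def cubeSums (S : Finset M) (n : ℕ) : Set M :=
  {b | ∃ m : Multiset M, (∀ x ∈ m, x ∈ S) ∧ m.card ≤ n ∧ m.sum = b}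

/-- `0 ∈ cubeSums S n` (the empty sum). [cite: Lothaire1997, Theorem 3.2.1] -/
theorem zero_mem_cubeSums (S : Finset M) (n : ℕ) : (0 : M) ∈ cubeSums S n :=
  ⟨0, by simp, by simp, by simp⟩

/-- **Theorem 3.2.1, uniform abstract form** (Grünwald / Gallai–Witt over any additive commutative
monoid): for a finite `S ⊆ M` and a finite set of colours `κ` there is `n = n(S, κ)` such that
every colouring `C : M → κ` admits a monochromatic homothetic copy `a • S + b` with `0 < a ≤ n`
and `b` a sum of at most `n` elements of `S`.  Derived from Mathlib's Hales–Jewett theorem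
(`Combinatorics.Line.exists_mono_in_high_dimension`), following Mathlib's proof of
`Combinatorics.exists_mono_homothetic_copy`; not the book's induction.
[cite: Lothaire1997, Theorem 3.2.1] -/
theorem exists_uniform_mono_homothetic (S : Finset M) (κ : Type*) [Finite κ] :
    ∃ n : ℕ, ∀ C : M → κ, ∃ (a : ℕ) (b : M) (c : κ), 0 < a ∧ a ≤ n ∧ b ∈ cubeSums S n ∧
      ∀ s ∈ S, C (a • s + b) = c := by
  classical
  obtain ⟨ι, _inst, hι⟩ := Combinatorics.Line.exists_mono_in_high_dimension S κ
  refine ⟨Fintype.card ι, fun C => ?_⟩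
  obtain ⟨l, c, hl⟩ := hι fun v => C (∑ i, (v i : M))
  set T : Finset ι := univ.filter fun i => l.idxFun i = none with hT
  let g : ι → M := fun i => ((l.idxFun i).map fun m : S => (m : M)).getD 0
  have hg : ∀ i, i ∉ T → ∃ y : S, l.idxFun i = some y ∧ g i = (y : M) := by
    intro i hi
    have hi' : l.idxFun i ≠ none := by simpa [hT] using hi
    obtain ⟨y, hy⟩ := Option.ne_none_iff_exists'.1 hi'
    exact ⟨y, hy, by simp [g, hy]⟩
  refine ⟨#T, ∑ i ∈ Tᶜ, g i, c, ?_, card_le_univ T, ?_, ?_⟩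
  · obtain ⟨i, hi⟩ := l.proper
    exact card_pos.2 ⟨i, by simp [hT, hi]⟩
  · refine ⟨(Tᶜ).1.map g, ?_, ?_, (Finset.sum_eq_multiset_sum _ _).symm⟩
    · intro x hx
      obtain ⟨i, hi, rfl⟩ := Multiset.mem_map.1 hx
      have hi' : i ∈ Tᶜ := Finset.mem_def.2 hi
      obtain ⟨y, -, hgy⟩ := hg i (Finset.mem_compl.1 hi')
      rw [hgy]
      exact y.2
    · simpa using card_le_univ Tᶜ
  · intro s hs
    have hl' : C (∑ i, ((l ⟨s, hs⟩ i : S) : M)) = c := hl ⟨s, hs⟩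
    rw [← hl']
    congr 1
    rw [← Finset.sum_add_sum_compl T fun i => ((l ⟨s, hs⟩ i : S) : M)]
    congr 1
    · rw [← Finset.sum_const]
      refine sum_congr rfl fun i hi => ?_
      rw [l.apply_none _ _ (mem_filter.1 hi).2]
    · refine sum_congr rfl fun i hi => ?_
      obtain ⟨y, hy, hgy⟩ := hg i (Finset.mem_compl.1 hi)
      rw [hgy, Combinatorics.Line.apply_some hy]

/-- In `ℕ`, a sum of at most `n` elements of `S ⊆ {0, …, B}` is at most `n B`.
[cite: Lothaire1997, Theorem 3.2.1] -/
theorem le_of_mem_cubeSums {S : Finset ℕ} {n B b : ℕ} (hb : b ∈ cubeSums S n)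
    (hB : ∀ s ∈ S, s ≤ B) : b ≤ n * B := by
  obtain ⟨m, hmS, hcard, rfl⟩ := hb
  calc m.sum ≤ m.card • B := Multiset.sum_le_card_nsmul m B fun x hx => hB x (hmS x hx)
    _ ≤ n * B := by rw [smul_eq_mul]; exact Nat.mul_le_mul_right _ hcard

/-- In `ℕ^d`, every coordinate of a sum of at most `n` elements of `S`, all of whose coordinates
are `≤ B`, is at most `n B`. [cite: Lothaire1997, Theorem 3.2.1] -/
theorem apply_le_of_mem_cubeSums {d : ℕ} {S : Finset (Fin d → ℕ)} {n B : ℕ} {v : Fin d → ℕ}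
    (hv : v ∈ cubeSums S n) (hB : ∀ s ∈ S, ∀ j, s j ≤ B) (j : Fin d) : v j ≤ n * B := by
  obtain ⟨m, hmS, hcard, rfl⟩ := hv
  have h1 : m.sum j = (m.map fun f => f j).sum := by
    change Pi.evalAddMonoidHom (fun _ : Fin d => ℕ) j m.sum = _
    rw [map_multiset_sum]
    rfl
  rw [h1]
  calc (m.map fun f => f j).sum ≤ (m.map fun f => f j).card • B :=
        Multiset.sum_le_card_nsmul _ B fun x hx => by
          obtain ⟨f, hf, rfl⟩ := Multiset.mem_map.1 hx
          exact hB f (hmS f hf) j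
    _ ≤ n * B := by rw [Multiset.card_map, smul_eq_mul]; exact Nat.mul_le_mul_right _ hcard

/-- **Theorem 3.2.1** (Grünwald; Gallai–Witt) as printed: for a finite `S ⊆ ℕ^d` and `κ` finite
there is a bound `B = B(S, κ)` such that every `κ`-colouring of `ℕ^d` has a monochromatic
`a S + v` with `0 < a ≤ B` and all coordinates of `v` at most `B`.  (Proof route: Hales–Jewett,
see the module docstring.) [cite: Lothaire1997, Theorem 3.2.1] -/
theorem grunwald (d : ℕ) (S : Finset (Fin d → ℕ)) (κ : Type*) [Finite κ] :
    ∃ B : ℕ, ∀ C : (Fin d → ℕ) → κ, ∃ (a : ℕ) (v : Fin d → ℕ) (c : κ),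
      0 < a ∧ a ≤ B ∧ (∀ j, v j ≤ B) ∧ ∀ s ∈ S, C (a • s + v) = c := by
  obtain ⟨n, hn⟩ := exists_uniform_mono_homothetic S κ
  set B₀ : ℕ := S.sup fun s => univ.sup s with hB₀
  have hcoord : ∀ s ∈ S, ∀ j, s j ≤ B₀ := fun s hs j =>
    (Finset.le_sup (f := s) (mem_univ j)).trans (Finset.le_sup (f := fun s => univ.sup s) hs)
  refine ⟨n * (B₀ + 1), fun C => ?_⟩
  obtain ⟨a, v, c, ha, han, hv, hmono⟩ := hn C
  refine ⟨a, v, c, ha, han.trans (Nat.le_mul_of_pos_right n (Nat.succ_pos _)), fun j => ?_, hmono⟩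
  exact (apply_le_of_mem_cubeSums hv hcoord j).trans (Nat.mul_le_mul_left n (Nat.le_succ _))

end Uniform

/-! ### §3.1 — van der Waerden's theorem -/

/-- **Theorem 3.1.3** (van der Waerden): for every finite set of colours `κ` (`k` classes) and
every `l` there is `N = N(k, l)` such that every colouring of `ℕ` restricted to `{0, …, N}` — i.e.
every partition of `{0, …, N}` into `k` classes — has a monochromatic arithmetic progression
`a, a + d, …, a + (l-1)d ⊆ {0, …, N}` with `d > 0`.  Derived from Theorem 3.2.1 (`d = 1`,
`S = {0, …, l-1}`), as the text does on p. 40. [cite: Lothaire1997, Theorem 3.1.3] -/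
theorem vanDerWaerden (κ : Type*) [Finite κ] (l : ℕ) :
    ∃ N : ℕ, ∀ c : ℕ → κ, ∃ a d : ℕ, 0 < d ∧ a + (l - 1) * d ≤ N ∧
      ∀ i < l, c (a + i * d) = c a := by
  obtain ⟨n, hn⟩ := exists_uniform_mono_homothetic (range l) κ
  refine ⟨2 * (n * (l - 1)), fun c => ?_⟩
  obtain ⟨d, a, col, hd, hdn, ha, hmono⟩ := hn c
  have hal : a ≤ n * (l - 1) :=
    le_of_mem_cubeSums ha fun s hs => Nat.le_sub_one_of_lt (mem_range.1 hs)
  refine ⟨a, d, hd, ?_, fun i hi => ?_⟩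
  · calc a + (l - 1) * d ≤ n * (l - 1) + (l - 1) * n :=
          Nat.add_le_add hal (Nat.mul_le_mul_left _ hdn)
      _ = 2 * (n * (l - 1)) := by ring
  · have h0 : c a = col := by simpa using hmono 0 (mem_range.2 (lt_of_le_of_lt (Nat.zero_le i) hi))
    have h1 := hmono i (mem_range.2 hi)
    rw [smul_eq_mul, mul_comm, add_comm] at h1
    rw [h1, h0]

/-- **Proposition 3.1.2** (Artin's form of Baudet's conjecture): if `ℕ` is partitioned into finitely
many classes, ONE of the classes contains arbitrarily long arithmetic progressions (the same class
for every length — obtained from Theorem 3.1.3 by the pigeonhole principle on the colours of the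
progressions of each length; "3.1.3 clearly implies 3.1.2", p. 39).
[cite: Lothaire1997, Proposition 3.1.2] -/
theorem exists_class_with_long_progressions (κ : Type*) [Finite κ] (c : ℕ → κ) :
    ∃ k₀ : κ, ∀ l : ℕ, ∃ a d : ℕ, 0 < d ∧ ∀ i < l, c (a + i * d) = k₀ := by
  classical
  have hvdw : ∀ l : ℕ, ∃ a d : ℕ, 0 < d ∧ ∀ i < l, c (a + i * d) = c a := by
    intro l
    obtain ⟨N, hN⟩ := vanDerWaerden κ l
    obtain ⟨a, d, hd, -, hmono⟩ := hN c
    exact ⟨a, d, hd, hmono⟩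
  choose a d hd hmono using hvdw
  -- the colour of the progression of length `l` is `c (a l)`; one colour occurs for infinitely
  -- many `l`
  obtain ⟨k₀, hk₀⟩ := Finite.exists_infinite_fiber fun l => c (a l)
  refine ⟨k₀, fun l => ?_⟩
  obtain ⟨l', hl', hll'⟩ := (Set.infinite_coe_iff.1 hk₀).exists_gt l
  have hcol : c (a l') = k₀ := hl'
  exact ⟨a l', d l', hd l', fun i hi => (hmono l' i (hi.trans hll')).trans hcol⟩

/-- **3.1.2 implies 3.1.3** (p. 39): if every colouring of `ℕ` with colours in the finite set `κ`
has a monochromatic arithmetic progression of length `l`, then there is a uniform `N` such that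
every colouring already has one inside `{0, …, N}`.  The text's compactness argument: were there bad
colourings `χ_n` of `{0, …, n}` for every `n`, a limit point `χ` of `(χ_n)` in the compact space
`κ^ℕ` would be a colouring of `ℕ` agreeing with some `χ_n`, `n ≥ r`, on any prescribed finite set
of positions `< r`; a monochromatic progression of `χ` then lies in some `{0, …, n}` and is
monochromatic for `χ_n` — a contradiction.  Here the limit point is taken along a non-principal
ultrafilter (`Filter.hyperfilter ℕ`), which replaces the extraction of a convergent subsequence.
[cite: Lothaire1997, Theorem 3.1.3 (proof of the equivalence with Proposition 3.1.2, p. 39)] -/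
theorem exists_bound_of_forall_coloring (κ : Type*) [Finite κ] (l : ℕ)
    (h : ∀ c : ℕ → κ, ∃ a d : ℕ, 0 < d ∧ ∀ i < l, c (a + i * d) = c a) :
    ∃ N : ℕ, ∀ c : ℕ → κ, ∃ a d : ℕ, 0 < d ∧ a + (l - 1) * d ≤ N ∧
      ∀ i < l, c (a + i * d) = c a := by
  classical
  by_contra hN
  push Not at hN
  choose cs hcs using hN
  -- the limit colouring `χ` along the hyperfilter
  set U : Ultrafilter ℕ := Filter.hyperfilter ℕ with hU
  have hlim : ∀ t : ℕ, ∃ k : κ, ∀ᶠ n in (U : Filter ℕ), cs n t = k := fun t =>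
    (Ultrafilter.eventually_exists_iff (f := U) (P := fun k n => cs n t = k)).1
      (Filter.Eventually.of_forall fun n => ⟨cs n t, rfl⟩)
  choose χ hχ using hlim
  obtain ⟨a, d, hd, hmono⟩ := h χ
  have hev : ∀ᶠ n in (U : Filter ℕ),
      (∀ i ∈ range l, cs n (a + i * d) = χ (a + i * d)) ∧ a + (l - 1) * d ≤ n := by
    refine ((Filter.eventually_all_finset (range l)).2 fun i _ => hχ (a + i * d)).and ?_
    have hmem : {n : ℕ | a + (l - 1) * d ≤ n} ∈ (U : Filter ℕ) := by
      apply Filter.mem_hyperfilter_of_finite_compl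
      simp only [Set.compl_setOf, not_le]
      exact Set.finite_lt_nat _
    exact hmem
  obtain ⟨n, hn, hle⟩ := hev.exists
  obtain ⟨i, hi, hne⟩ := hcs n a d hd hle
  apply hne
  have hl : 0 < l := lt_of_le_of_lt (Nat.zero_le i) hi
  have h0 : cs n a = χ a := by simpa using hn 0 (mem_range.2 hl)
  rw [hn i (mem_range.2 hi), h0, hmono i hi]

/-- The equivalence of the two classical formulations for a fixed number of classes, both
directions (p. 39): (every colouring of `ℕ` has monochromatic progressions of every length) iff
(for every `l` a uniform `N(l)` exists). [cite: Lothaire1997, Theorem 3.1.3 (equivalence with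
Proposition 3.1.2, p. 39)] -/
theorem forall_coloring_iff_exists_bound (κ : Type*) [Finite κ] :
    (∀ l : ℕ, ∀ c : ℕ → κ, ∃ a d : ℕ, 0 < d ∧ ∀ i < l, c (a + i * d) = c a) ↔
    (∀ l : ℕ, ∃ N : ℕ, ∀ c : ℕ → κ, ∃ a d : ℕ, 0 < d ∧ a + (l - 1) * d ≤ N ∧
      ∀ i < l, c (a + i * d) = c a) := by
  refine ⟨fun h l => exists_bound_of_forall_coloring κ l (h l), fun h l c => ?_⟩
  obtain ⟨N, hN⟩ := h l
  obtain ⟨a, d, hd, -, hmono⟩ := hN c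
  exact ⟨a, d, hd, hmono⟩

/-! ### §3.3 — cadences -/

section Cadences

variable {α : Type*}

/-- `T` is a **cadence** of the word `u = a₁ ⋯ a_r`: `T ⊆ {1, …, r}` and all the letters `a_t`,
`t ∈ T`, are equal (p. 42; positions are 1-indexed as in the text, so `a_t = u[t-1]`).  The order
of the cadence is `#T`; the text's `T = {t₁ < ⋯ < tₙ}` is nonempty, we allow `T = ∅` (a cadence of
order `0`) harmlessly. [cite: Lothaire1997, §3.3 (definition of a cadence, p. 42)] -/
def IsCadence (u : List α) (T : Finset ℕ) : Prop :=
  (∀ t ∈ T, 1 ≤ t ∧ t ≤ u.length) ∧ ∀ t ∈ T, ∀ t' ∈ T, u[t - 1]? = u[t' - 1]?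

/-- Cadences of explicit words are decidable (used for the examples of p. 42).
[cite: Lothaire1997, §3.3 (p. 42)] -/
instance [DecidableEq α] (u : List α) (T : Finset ℕ) : Decidable (IsCadence u T) := by
  unfold IsCadence; infer_instance

/-- A sub(set of a) cadence is a cadence. [cite: Lothaire1997, §3.3 (p. 42)] -/
theorem IsCadence.subset {u : List α} {T T' : Finset ℕ} (h : IsCadence u T) (hT : T' ⊆ T) :
    IsCadence u T' :=
  ⟨fun t ht => h.1 t (hT ht), fun t ht t' ht' => h.2 t (hT ht) t' (hT ht')⟩

/-- A **cadence of type `S`** of `u`: a cadence of the form `α S + β` with `α, β > 0`.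
[cite: Lothaire1997, §3.3 (definition, p. 42)] -/
def IsCadenceOfType (S : Finset ℕ) (u : List α) (T : Finset ℕ) : Prop :=
  IsCadence u T ∧ ∃ a b : ℕ, 0 < a ∧ 0 < b ∧ T = S.image fun s => a * s + b

/-- `u` has an **arithmetic cadence of order `n`** (with some common difference `α > 0`): a
cadence `α {0, …, n-1} + β`, `α, β > 0`. [cite: Lothaire1997, §3.3 (definition, p. 42)] -/
def HasArithCadence (u : List α) (n : ℕ) : Prop :=
  ∃ a b : ℕ, 0 < a ∧ 0 < b ∧ IsCadence u ((range n).image fun s => a * s + b)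

/-- An arithmetic cadence of order `n` is exactly a cadence of type `{0, …, n-1}`.
[cite: Lothaire1997, §3.3 (p. 42)] -/
theorem hasArithCadence_iff_exists_cadenceOfType (u : List α) (n : ℕ) :
    HasArithCadence u n ↔ ∃ T, IsCadenceOfType (range n) u T := by
  constructor
  · rintro ⟨a, b, ha, hb, hT⟩
    exact ⟨_, hT, a, b, ha, hb, rfl⟩
  · rintro ⟨T, hT, a, b, ha, hb, rfl⟩
    exact ⟨a, b, ha, hb, hT⟩

/-- Arithmetic cadences of order `n` contain arithmetic cadences of every smaller order.
[cite: Lothaire1997, §3.3 (p. 42)] -/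
theorem HasArithCadence.mono {u : List α} {m n : ℕ} (h : HasArithCadence u n) (hmn : m ≤ n) :
    HasArithCadence u m := by
  obtain ⟨a, b, ha, hb, hT⟩ := h
  exact ⟨a, b, ha, hb, hT.subset (image_subset_image fun x hx =>
    mem_range.2 (lt_of_lt_of_le (mem_range.1 hx) hmn))⟩

/-- The book's deduction of Proposition 3.3.2 from Proposition 3.3.1 for one word (p. 42): if
`S ⊆ {0, …, m}` and `u` has an arithmetic cadence `α {0, …, m} + β` of order `m + 1`, then
`α S + β` is a cadence of type `S` of `u`. [cite: Lothaire1997, Propositions 3.3.1–3.3.2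
(proof of the equivalence, p. 42)] -/
theorem exists_cadenceOfType_of_hasArithCadence {u : List α} {S : Finset ℕ} {m : ℕ}
    (hS : ∀ s ∈ S, s ≤ m) (h : HasArithCadence u (m + 1)) : ∃ T, IsCadenceOfType S u T := by
  obtain ⟨a, b, ha, hb, hT⟩ := h
  refine ⟨S.image fun s => a * s + b, hT.subset (image_subset_image fun s hs => ?_), a, b, ha, hb,
    rfl⟩
  exact mem_range.2 (Nat.lt_succ_of_le (hS s hs))

/-- **Proposition 3.3.2**: for a finite `S ⊆ ℕ` and a finite alphabet there is `N = N(S, A)` such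
that every word of length `≥ N` has a cadence of type `S`.  (From the uniform Theorem 3.2.1 with
`d = 1`, colouring position `m` of `ℕ` by the letter `u[m]`, or by "none" beyond the word.)
[cite: Lothaire1997, Proposition 3.3.2] -/
theorem exists_length_forcing_cadenceOfType (S : Finset ℕ) (α : Type*) [Finite α] :
    ∃ N : ℕ, ∀ u : List α, N ≤ u.length → ∃ T, IsCadenceOfType S u T := by
  obtain ⟨n, hn⟩ := exists_uniform_mono_homothetic S (Option α)
  set B : ℕ := S.sup id with hB
  have hSB : ∀ s ∈ S, s ≤ B := fun s hs => Finset.le_sup (f := id) hs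
  refine ⟨2 * (n * B) + 1, fun u hu => ?_⟩
  obtain ⟨a, b, c, ha, han, hb, hmono⟩ := hn fun m => u[m]?
  have hbB : b ≤ n * B := le_of_mem_cubeSums hb hSB
  have hpos : ∀ s ∈ S, a * s + b < u.length := fun s hs =>
    calc a * s + b ≤ n * B + n * B := Nat.add_le_add (Nat.mul_le_mul han (hSB s hs)) hbB
      _ < 2 * (n * B) + 1 := by omega
      _ ≤ u.length := hu
  refine ⟨S.image fun s => a * s + (b + 1), ⟨?_, ?_⟩, a, b + 1, ha, Nat.succ_pos b, rfl⟩
  · intro t ht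
    obtain ⟨s, hs, rfl⟩ := mem_image.1 ht
    exact ⟨by omega, by have := hpos s hs; omega⟩
  · intro t ht t' ht'
    obtain ⟨s, hs, rfl⟩ := mem_image.1 ht
    obtain ⟨s', hs', rfl⟩ := mem_image.1 ht'
    have h1 : u[a • s + b]? = c := hmono s hs
    have h2 : u[a • s' + b]? = c := hmono s' hs'
    rw [smul_eq_mul] at h1 h2
    have e : ∀ x, x + (b + 1) - 1 = x + b := fun x => by omega
    rw [e, e, h1, h2]

/-- **Proposition 3.3.1**: for a finite alphabet and every `n` there is `N = N(A, n)` such that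
every word of length `≥ N` has an arithmetic cadence of order `n` ("3.3.1 follows from 3.3.2 by
setting `S = {0, 1, …, n-1}`", p. 42). [cite: Lothaire1997, Proposition 3.3.1] -/
theorem exists_length_forcing_arithCadence (α : Type*) [Finite α] (n : ℕ) :
    ∃ N : ℕ, ∀ u : List α, N ≤ u.length → HasArithCadence u n := by
  obtain ⟨N, hN⟩ := exists_length_forcing_cadenceOfType (range n) α
  exact ⟨N, fun u hu => (hasArithCadence_iff_exists_cadenceOfType u n).2 (hN u hu)⟩

/-- The equivalence of Propositions 3.3.1 and 3.3.2 for a fixed alphabet, with the book's proof in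
both directions (`S = {0, …, n-1}`; conversely `m = max S` and an arithmetic cadence of order
`m + 1` restricts to a cadence of type `S`). [cite: Lothaire1997, Propositions 3.3.1–3.3.2
(equivalence, p. 42)] -/
theorem forcing_arithCadence_iff_forcing_cadenceOfType (α : Type*) :
    (∀ n : ℕ, ∃ N : ℕ, ∀ u : List α, N ≤ u.length → HasArithCadence u n) ↔
    (∀ S : Finset ℕ, ∃ N : ℕ, ∀ u : List α, N ≤ u.length → ∃ T, IsCadenceOfType S u T) := by
  constructor
  · intro h S
    obtain ⟨N, hN⟩ := h (S.sup id + 1)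
    exact ⟨N, fun u hu => exists_cadenceOfType_of_hasArithCadence
      (fun s hs => Finset.le_sup (f := id) hs) (hN u hu)⟩
  · intro h n
    obtain ⟨N, hN⟩ := h (range n)
    exact ⟨N, fun u hu => (hasArithCadence_iff_exists_cadenceOfType u n).2 (hN u hu)⟩

/-- A bounded search form of `HasArithCadence` (for `decide`): for order `n ≥ 2` the common
difference and the first position of an arithmetic cadence are at most `|u|`, and the cadence
condition reads `u[b-1 + i a] = u[b-1]` for `i < n`. [cite: Lothaire1997, §3.3 (p. 42)] -/
theorem hasArithCadence_iff_bounded [DecidableEq α] (u : List α) {n : ℕ} (hn : 2 ≤ n) :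
    HasArithCadence u n ↔ ∃ a ∈ range (u.length + 1), ∃ b ∈ range (u.length + 1),
      0 < a ∧ 0 < b ∧ b + (n - 1) * a ≤ u.length ∧ ∀ i < n, u[b - 1 + i * a]? = u[b - 1]? := by
  have key : ∀ a b : ℕ, 0 < a → 0 < b →
      (IsCadence u ((range n).image fun s => a * s + b) ↔
        b + (n - 1) * a ≤ u.length ∧ ∀ i < n, u[b - 1 + i * a]? = u[b - 1]?) := by
    intro a b ha hb
    constructor
    · rintro ⟨hle, heq⟩
      refine ⟨?_, fun i hi => ?_⟩
      · have := (hle (a * (n - 1) + b) (mem_image.2 ⟨n - 1, mem_range.2 (by omega), rfl⟩)).2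
        rw [mul_comm] at this; omega
      · have h := heq (a * i + b) (mem_image.2 ⟨i, mem_range.2 hi, rfl⟩) (a * 0 + b)
          (mem_image.2 ⟨0, mem_range.2 (by omega), rfl⟩)
        have e1 : a * i + b - 1 = b - 1 + i * a := by rw [mul_comm]; omega
        have e2 : a * 0 + b - 1 = b - 1 := by simp
        rw [e1, e2] at h
        exact h
    · rintro ⟨hle, heq⟩
      refine ⟨fun t ht => ?_, fun t ht t' ht' => ?_⟩
      · obtain ⟨i, hi, rfl⟩ := mem_image.1 ht
        have hi' := mem_range.1 hi
        refine ⟨by omega, ?_⟩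
        have : a * i ≤ a * (n - 1) := Nat.mul_le_mul_left a (by omega)
        rw [mul_comm a (n - 1)] at this
        omega
      · obtain ⟨i, hi, rfl⟩ := mem_image.1 ht
        obtain ⟨i', hi', rfl⟩ := mem_image.1 ht'
        have e1 : a * i + b - 1 = b - 1 + i * a := by rw [mul_comm]; omega
        have e2 : a * i' + b - 1 = b - 1 + i' * a := by rw [mul_comm]; omega
        rw [e1, e2, heq i (mem_range.1 hi), heq i' (mem_range.1 hi')]
  constructor
  · rintro ⟨a, b, ha, hb, hT⟩
    obtain ⟨hle, hall⟩ := (key a b ha hb).1 hT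
    have hb' : b ≤ u.length := by
      have : (n - 1) * a ≥ 0 := Nat.zero_le _
      omega
    have ha' : a ≤ u.length := by
      have : (n - 1) * a ≥ 1 * a := Nat.mul_le_mul_right a (by omega)
      omega
    exact ⟨a, mem_range.2 (Nat.lt_succ_of_le ha'), b, mem_range.2 (Nat.lt_succ_of_le hb'), ha, hb,
      hle, hall⟩
  · rintro ⟨a, -, b, -, ha, hb, h⟩
    exact ⟨a, b, ha, hb, (key a b ha hb).2 h⟩

/-! #### The examples of p. 42 (letters `a = 0`, `b = 1`) -/

/-- The word `abbabbaab` of the first example of p. 42.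
[cite: Lothaire1997, §3.3 (Example, p. 42)] -/
def abbabbaab : List (Fin 2) := [0, 1, 1, 0, 1, 1, 0, 0, 1]

/-- The word `abbaabba` of the second example of p. 42.
[cite: Lothaire1997, §3.3 (Example, p. 42)] -/
def abbaabba : List (Fin 2) := [0, 1, 1, 0, 0, 1, 1, 0]

/-- First example of p. 42: the positions `{3, 6, 9}` (the letters `b` printed in bold face) form an
arithmetic cadence of `abbabbaab` with common difference `α = 3` and `β = 3`, i.e.
`3·{0, 1, 2} + 3`.  The text prints "of order 4 (`S = {0, 1, 2, 3}`)", but `3·3 + 3 = 12` exceeds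
the length `9` of the printed word; we record the order-3 cadence that the bold letters show.
[cite: Lothaire1997, §3.3 (Example, p. 42)] -/
theorem abbabbaab_cadence :
    IsCadence abbabbaab {3, 6, 9} ∧ IsCadenceOfType (range 3) abbabbaab {3, 6, 9} ∧
      HasArithCadence abbabbaab 3 := by
  have h369 : ({3, 6, 9} : Finset ℕ) = (range 3).image fun s => 3 * s + 3 := by decide
  have hcad : IsCadence abbabbaab {3, 6, 9} := by decide
  refine ⟨hcad, ?_, ?_⟩
  · exact ⟨hcad, 3, 3, by norm_num, by norm_num, h369⟩
  · refine ⟨3, 3, by norm_num, by norm_num, ?_⟩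
    rw [← h369]
    exact hcad

/-- Second example of p. 42: `{1, 4, 5, 8}` is a cadence of `abbaabba` …
[cite: Lothaire1997, §3.3 (Example, p. 42)] -/
theorem abbaabba_cadence : IsCadence abbaabba {1, 4, 5, 8} := by decide

/-- … and `abbaabba` has no arithmetic cadence of order greater than `2`.
[cite: Lothaire1997, §3.3 (Example, p. 42)] -/
theorem abbaabba_no_arithCadence {n : ℕ} (hn : 3 ≤ n) : ¬ HasArithCadence abbaabba n := by
  intro h
  have h3 : HasArithCadence abbaabba 3 := h.mono hn
  rw [hasArithCadence_iff_bounded _ (by norm_num)] at h3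
  revert h3
  decide

/-! #### The value `N(2, 3) = 9` (table of p. 46) in the language of cadences

The table of known values of `N(k, l)` on p. 46 gives `N(2, 3) = 9`: every partition of
`{1, …, 9}` into two classes has a class containing a `3`-term arithmetic progression, and `8`
points do not suffice.  In the language of §3.3: every binary word of length `≥ 9` has an
arithmetic cadence of order `3` (certified below by a kernel-checked search over the `2⁹` binary
words of length `9`), while `abbaabba` (length `8`) has none (`abbaabba_no_arithCadence`). -/

/-- A cadence of a prefix of `u` is a cadence of `u`. [cite: Lothaire1997, §3.3 (p. 42)] -/
theorem IsCadence.of_take {u : List α} {m : ℕ} {T : Finset ℕ} (h : IsCadence (u.take m) T) :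
    IsCadence u T := by
  refine ⟨fun t ht => ⟨(h.1 t ht).1, ?_⟩, fun t ht t' ht' => ?_⟩
  · have := (h.1 t ht).2
    rw [List.length_take] at this
    omega
  · obtain ⟨h0, h1⟩ := h.1 t ht
    obtain ⟨h0', h2⟩ := h.1 t' ht'
    rw [List.length_take] at h1 h2
    have hlt : t - 1 < m := by omega
    have hlt' : t' - 1 < m := by omega
    have := h.2 t ht t' ht'
    rwa [List.getElem?_take_of_lt hlt, List.getElem?_take_of_lt hlt'] at this

/-- An arithmetic cadence of a prefix of `u` is one of `u`. [cite: Lothaire1997, §3.3 (p. 42)] -/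
theorem HasArithCadence.of_take {u : List α} {m n : ℕ} (h : HasArithCadence (u.take m) n) :
    HasArithCadence u n := by
  obtain ⟨a, b, ha, hb, hT⟩ := h
  exact ⟨a, b, ha, hb, hT.of_take⟩

/-- All binary words of length `n` (an enumeration for the kernel-checked search below).
[cite: Lothaire1997, §3.5 (table of N(k, l), p. 46)] -/
def binaryWords : ℕ → List (List (Fin 2))
  | 0 => [[]]
  | n + 1 => (binaryWords n).flatMap fun w => [0 :: w, 1 :: w]

/-- `binaryWords n` lists exactly the binary words of length `n`.
[cite: Lothaire1997, §3.5 (table of N(k, l), p. 46)] -/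
theorem mem_binaryWords {n : ℕ} {w : List (Fin 2)} : w ∈ binaryWords n ↔ w.length = n := by
  induction n generalizing w with
  | zero => simp [binaryWords, List.length_eq_zero_iff]
  | succ n ih =>
    simp only [binaryWords, List.mem_flatMap, List.mem_cons, List.not_mem_nil, or_false]
    constructor
    · rintro ⟨w', hw', rfl | rfl⟩ <;> simp [ih.1 hw']
    · intro hw
      cases w with
      | nil => simp at hw
      | cons x w' =>
        refine ⟨w', ih.2 (by simpa using hw), ?_⟩
        have hx : x = 0 ∨ x = 1 := by omega
        rcases hx with rfl | rfl
        · exact Or.inl rfl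
        · exact Or.inr rfl

/-- A search for an arithmetic cadence of order `3` (bounded form of `HasArithCadence _ 3`).
[cite: Lothaire1997, §3.5 (table of N(k, l), p. 46)] -/
def findArithCadence₃ (u : List (Fin 2)) : Bool :=
  (List.range (u.length + 1)).any fun a => (List.range (u.length + 1)).any fun b =>
    decide (0 < a) && decide (0 < b) && decide (b + 2 * a ≤ u.length) &&
      decide (u[b - 1 + a]? = u[b - 1]?) && decide (u[b - 1 + 2 * a]? = u[b - 1]?)

/-- Soundness of the search. [cite: Lothaire1997, §3.5 (table of N(k, l), p. 46)] -/
theorem hasArithCadence_of_findArithCadence₃ {u : List (Fin 2)} (h : findArithCadence₃ u = true) :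
    HasArithCadence u 3 := by
  simp only [findArithCadence₃, List.any_eq_true, List.mem_range, Bool.and_eq_true,
    decide_eq_true_eq] at h
  obtain ⟨a, ha', b, hb', ⟨⟨⟨ha, hb⟩, hle⟩, h1⟩, h2⟩ := h
  have hall : ∀ i < 3, u[b - 1 + i * a]? = u[b - 1]? := by
    intro i hi
    have hi' : i = 0 ∨ i = 1 ∨ i = 2 := by omega
    rcases hi' with rfl | rfl | rfl
    · simp
    · simpa using h1
    · simpa using h2
  exact (hasArithCadence_iff_bounded u (by norm_num)).2
    ⟨a, mem_range.2 ha', b, mem_range.2 hb', ha, hb, by omega, hall⟩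

/-- The kernel-checked search: every binary word of length `9` has an arithmetic cadence of
order `3`. [cite: Lothaire1997, §3.5 (table of N(k, l), p. 46)] -/
theorem findArithCadence₃_binaryWords_nine : ∀ w ∈ binaryWords 9, findArithCadence₃ w = true := by
  decide +kernel

/-- **`N(2, 3) = 9`** (table of p. 46), cadence form: every binary word of length at least `9` has
an arithmetic cadence of order `3`, and the binary word `abbaabba` of length `8` (example of
p. 42) has none. [cite: Lothaire1997, §3.5 (table of N(k, l), p. 46: N(2, 3) = 9)] -/
theorem vanDerWaerdenNumber_two_three :
    (∀ u : List (Fin 2), 9 ≤ u.length → HasArithCadence u 3) ∧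
      (abbaabba.length = 8 ∧ ¬ HasArithCadence abbaabba 3) := by
  refine ⟨fun u hu => ?_, by decide, abbaabba_no_arithCadence le_rfl⟩
  have h9 : (u.take 9).length = 9 := by
    rw [List.length_take]
    omega
  exact (hasArithCadence_of_findArithCadence₃
    (findArithCadence₃_binaryWords_nine _ (mem_binaryWords.2 h9))).of_take

end Cadences

/-! ### §3.5 — the Erdős–Rado lower bound (3.5.1) and Problem 3.5.1 -/

section ErdosRado

/-- The pairs `(y, x)` with `x < y < N`, as a sigma-type finset; there are `N(N-1)/2` of them.
[cite: Lothaire1997, §3.5 (proof of (3.5.1), p. 47)] -/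
def lowerPairs (N : ℕ) : Finset (Σ _ : ℕ, ℕ) := (range N).sigma fun y => range y

/-- `2 · #lowerPairs N = N (N - 1)`. [cite: Lothaire1997, §3.5 (proof of (3.5.1), p. 47)] -/
theorem card_lowerPairs_mul_two (N : ℕ) : #(lowerPairs N) * 2 = N * (N - 1) := by
  rw [lowerPairs, card_sigma]
  simp only [card_range]
  exact sum_range_id_mul_two N

/-- The arithmetic progressions `a, a + d, …, a + l d` (`d > 0`) inside `{0, …, N-1}`, as pairs
`(a, d)`. [cite: Lothaire1997, §3.5 (proof of (3.5.1), p. 47)] -/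
def progParams (N l : ℕ) : Finset (ℕ × ℕ) :=
  (range N ×ˢ range N).filter fun p => 0 < p.2 ∧ p.1 + l * p.2 < N

/-- Membership in `progParams`. [cite: Lothaire1997, §3.5 (proof of (3.5.1), p. 47)] -/
theorem mem_progParams {N l : ℕ} {p : ℕ × ℕ} (hl : 0 < l) :
    p ∈ progParams N l ↔ 0 < p.2 ∧ p.1 + l * p.2 < N := by
  simp only [progParams, mem_filter, mem_product, mem_range]
  constructor
  · rintro ⟨-, h⟩; exact h
  · rintro ⟨hd, hlt⟩
    refine ⟨⟨by omega, ?_⟩, hd, hlt⟩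
    have : p.2 ≤ l * p.2 := Nat.le_mul_of_pos_left _ hl
    omega

/-- The count of progressions (p. 47: `M < N²/2l`): `2 l · #{(l+1)-term progressions in an
`N`-set} ≤ N (N - 1)`, by the injection `((a, d), i) ↦ (a + l d - i, a)` (`0 ≤ i < l`) into the
pairs `x < y < N`. [cite: Lothaire1997, §3.5 (proof of (3.5.1), p. 47)] -/
theorem two_mul_mul_card_progParams_le (N l : ℕ) (hl : 0 < l) :
    2 * l * #(progParams N l) ≤ N * (N - 1) := by
  classical
  have hinj : #(progParams N l ×ˢ range l) ≤ #(lowerPairs N) := by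
    refine card_le_card_of_injOn (fun q => ⟨q.1.1 + l * q.1.2 - q.2, q.1.1⟩) ?_ ?_
    · intro q hq
      obtain ⟨hp, hi⟩ := mem_product.1 (mem_coe.1 hq)
      obtain ⟨hd, hlt⟩ := (mem_progParams hl).1 hp
      have hi' := mem_range.1 hi
      have hA : l ≤ l * q.1.2 := Nat.le_mul_of_pos_right _ hd
      rw [mem_coe, lowerPairs, mem_sigma, mem_range, mem_range]
      dsimp only
      exact ⟨by omega, by omega⟩
    · intro q hq q' hq' hqq'
      obtain ⟨hp, hi⟩ := mem_product.1 (mem_coe.1 hq)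
      obtain ⟨hp', hi'⟩ := mem_product.1 (mem_coe.1 hq')
      obtain ⟨hd, -⟩ := (mem_progParams hl).1 hp
      obtain ⟨hd', -⟩ := (mem_progParams hl).1 hp'
      have hi := mem_range.1 hi
      have hi' := mem_range.1 hi'
      have hA : l ≤ l * q.1.2 := Nat.le_mul_of_pos_right _ hd
      have hA' : l ≤ l * q'.1.2 := Nat.le_mul_of_pos_right _ hd'
      simp only [Sigma.mk.injEq, heq_eq_eq] at hqq'
      obtain ⟨h1, h2⟩ := hqq'
      -- `a = a'` and `l d - i = l d' - i'` with `i, i' < l` force `d = d'`, `i = i'`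
      have hdd : q.1.2 = q'.1.2 := by
        by_contra hne
        rcases Nat.lt_or_gt_of_ne hne with hlt | hlt
        · have : l * q.1.2 + l ≤ l * q'.1.2 := by
            simpa [Nat.mul_succ] using Nat.mul_le_mul_left l (Nat.succ_le_of_lt hlt)
          omega
        · have : l * q'.1.2 + l ≤ l * q.1.2 := by
            simpa [Nat.mul_succ] using Nat.mul_le_mul_left l (Nat.succ_le_of_lt hlt)
          omega
      have hii : q.2 = q'.2 := by
        rw [hdd] at h1
        omega
      exact Prod.ext (Prod.ext h2 hdd) hii
  have h2 := card_lowerPairs_mul_two N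
  rw [card_product, card_range] at hinj
  calc 2 * l * #(progParams N l) = #(progParams N l) * l * 2 := by ring
    _ ≤ #(lowerPairs N) * 2 := Nat.mul_le_mul_right 2 hinj
    _ = N * (N - 1) := h2

/-- **The Erdős–Rado lower bound (3.5.1)** with the counting proof of p. 47: if EVERY partition of
the `N`-element interval `{0, …, N-1}` into `k ≥ 1` classes has a class containing an arithmetic
progression of length `l` (i.e. `N ≥ N(k, l)`, the book's `N(k, l)` being the least size of an
interval with this property, p. 46), then `2 (l - 1) k^{l-1} < N²`; in particular
`N(k, l) ≥ (2(l-1)k^{l-1})^{1/2}`, which is (3.5.1).  Proof: there are `k^N`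
colourings; those monochromatic on a fixed `l`-term progression number `k^{N-l+1}`; the
progressions number `M` with `2(l-1)M ≤ N(N-1)`; hence `k^N ≤ M k^{N-l+1}`.
[cite: Lothaire1997, §3.5 ((3.5.1) and its proof, p. 47)] -/
theorem erdosRado_lower_bound {N k l : ℕ} (hk : 1 ≤ k)
    (h : ∀ c : ℕ → Fin k, ∃ a d : ℕ, 0 < d ∧ a + (l - 1) * d < N ∧
      ∀ i < l, c (a + i * d) = c a) :
    2 * (l - 1) * k ^ (l - 1) < N ^ 2 := by
  classical
  -- `N ≥ 1` (apply `h` to any colouring)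
  obtain ⟨a₀, d₀, -, hN0, -⟩ := h fun _ => ⟨0, hk⟩
  have hN : 1 ≤ N := by omega
  -- the degenerate orders `l ≤ 1`
  rcases Nat.lt_or_ge l 2 with hl | hl
  · have : l - 1 = 0 := by omega
    rw [this, Nat.mul_zero, Nat.zero_mul]
    exact Nat.pow_pos hN
  set l' := l - 1 with hl'
  have hl'pos : 0 < l' := by omega
  -- extension of a colouring of `Fin N` to `ℕ`
  let ext : (Fin N → Fin k) → ℕ → Fin k := fun f m => if hm : m < N then f ⟨m, hm⟩ else ⟨0, hk⟩
  have hext : ∀ f : Fin N → Fin k, ∀ m (hm : m < N), ext f m = f ⟨m, hm⟩ := fun f m hm => by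
    simp [ext, hm]
  -- the bad sets
  let Bad : ℕ × ℕ → Finset (Fin N → Fin k) := fun p =>
    univ.filter fun f => ∀ i < l, ext f (p.1 + i * p.2) = ext f p.1
  -- every colouring is bad for some progression
  have hcover : (univ : Finset (Fin N → Fin k)) ⊆ (progParams N l').biUnion Bad := by
    intro f _
    obtain ⟨a, d, hd, hlt, hmono⟩ := h (ext f)
    exact mem_biUnion.2 ⟨(a, d), (mem_progParams hl'pos).2 ⟨hd, hlt⟩,
      mem_filter.2 ⟨mem_univ _, hmono⟩⟩
  -- `#Bad p ≤ k^(N - l')` for `p ∈ progParams`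
  have hbad : ∀ p ∈ progParams N l', #(Bad p) ≤ k ^ (N - l') := by
    intro p hp
    obtain ⟨hd, hlt⟩ := (mem_progParams hl'pos).1 hp
    have ha : p.1 < N := by
      have : 0 ≤ l' * p.2 := Nat.zero_le _
      omega
    -- the `l'` forced positions `a + i d`, `1 ≤ i ≤ l'`, as elements of `Fin N`
    have hIcc : ∀ i ∈ Icc 1 l', p.1 + i * p.2 < N := fun i hi => by
      have hi' := (mem_Icc.1 hi).2
      have : i * p.2 ≤ l' * p.2 := Nat.mul_le_mul_right _ hi'
      omega
    let emb : {i // i ∈ Icc 1 l'} → Fin N := fun i => ⟨p.1 + i.1 * p.2, hIcc i.1 i.2⟩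
    have hemb : Function.Injective emb := by
      intro i j hij
      have hij' : p.1 + i.1 * p.2 = p.1 + j.1 * p.2 := congrArg Fin.val hij
      have : i.1 * p.2 = j.1 * p.2 := by omega
      exact Subtype.ext (Nat.eq_of_mul_eq_mul_right hd this)
    let Q : Finset (Fin N) := (Icc 1 l').attach.image emb
    have hQcard : #Q = l' := by
      simp only [Q]
      rw [card_image_of_injective _ hemb, card_attach, Nat.card_Icc, Nat.add_sub_cancel]
    have haQ : (⟨p.1, ha⟩ : Fin N) ∉ Q := by
      intro hmem
      obtain ⟨i, -, hx⟩ := mem_image.1 hmem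
      have hx' : p.1 + i.1 * p.2 = p.1 := congrArg Fin.val hx
      have hi1 := (mem_Icc.1 i.2).1
      have : 1 * p.2 ≤ i.1 * p.2 := Nat.mul_le_mul_right _ hi1
      omega
    have hres : #(Bad p) ≤ #(univ : Finset ({x : Fin N // x ∉ Q} → Fin k)) := by
      refine card_le_card_of_injOn (fun f => f ∘ Subtype.val) (fun _ _ => mem_coe.2 (mem_univ _))
        ?_
      intro f hf g hg hfg
      have hf' := (mem_filter.1 (mem_coe.1 hf)).2
      have hg' := (mem_filter.1 (mem_coe.1 hg)).2
      have hfa : f ⟨p.1, ha⟩ = g ⟨p.1, ha⟩ := by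
        have := congr_fun hfg ⟨⟨p.1, ha⟩, haQ⟩
        simpa using this
      funext x
      by_cases hx : x ∈ Q
      · obtain ⟨i, -, hxi⟩ := mem_image.1 hx
        subst hxi
        have hil : i.1 < l := by have := (mem_Icc.1 i.2).2; omega
        have e1 : f (emb i) = ext f (p.1 + i.1 * p.2) := (hext f _ (hIcc i.1 i.2)).symm
        have e2 : g (emb i) = ext g (p.1 + i.1 * p.2) := (hext g _ (hIcc i.1 i.2)).symm
        rw [e1, e2, hf' i.1 hil, hg' i.1 hil, hext f _ ha, hext g _ ha, hfa]
      · have := congr_fun hfg ⟨x, hx⟩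
        simpa using this
    refine hres.trans ?_
    rw [card_univ, Fintype.card_fun, Fintype.card_fin, Fintype.card_subtype_compl,
      Fintype.card_fin, Fintype.card_coe, hQcard]
  -- the count
  have hcount : k ^ N ≤ #(progParams N l') * k ^ (N - l') := by
    calc k ^ N = #(univ : Finset (Fin N → Fin k)) := by
          rw [card_univ, Fintype.card_fun, Fintype.card_fin, Fintype.card_fin]
      _ ≤ #((progParams N l').biUnion Bad) := card_le_card hcover
      _ ≤ ∑ p ∈ progParams N l', #(Bad p) := card_biUnion_le
      _ ≤ ∑ _p ∈ progParams N l', k ^ (N - l') := sum_le_sum hbad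
      _ = #(progParams N l') * k ^ (N - l') := by rw [sum_const, smul_eq_mul]
  -- some progression fits, so `l' ≤ N - 1`
  have hl'N : l' < N := by
    obtain ⟨a, d, hd, hlt, -⟩ := h fun _ => ⟨0, hk⟩
    have : l' ≤ l' * d := Nat.le_mul_of_pos_right _ hd
    omega
  have hkl : k ^ l' ≤ #(progParams N l') := by
    have hpow : k ^ N = k ^ l' * k ^ (N - l') := by rw [← pow_add]; congr 1; omega
    rw [hpow] at hcount
    exact Nat.le_of_mul_le_mul_right hcount (Nat.pow_pos hk)
  have hM := two_mul_mul_card_progParams_le N l' hl'pos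
  calc 2 * l' * k ^ l' ≤ 2 * l' * #(progParams N l') := Nat.mul_le_mul_left _ hkl
    _ ≤ N * (N - 1) := hM
    _ < N ^ 2 := by
      rw [sq]
      calc N * (N - 1) < N * (N - 1) + N := Nat.lt_add_of_pos_right hN
        _ = N * (N - 1 + 1) := (Nat.mul_succ _ _).symm
        _ = N * N := by rw [Nat.sub_add_cancel hN]

end ErdosRado

/-- **Problem 3.5.1**: if `ℕ` is partitioned into finitely many classes, one class contains
arbitrarily long geometric progressions `a, a r, …, a r^{l-1}` (`r ≥ 2`).  The hint's proof:
colour `n` by the class of `2^n` and apply van der Waerden's theorem (Proposition 3.1.2).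
[cite: Lothaire1997, Problem 3.5.1] -/
theorem exists_class_with_long_geometric_progressions (κ : Type*) [Finite κ] (c : ℕ → κ) :
    ∃ k₀ : κ, ∀ l : ℕ, ∃ a r : ℕ, 0 < a ∧ 2 ≤ r ∧ ∀ i < l, c (a * r ^ i) = k₀ := by
  obtain ⟨k₀, hk₀⟩ := exists_class_with_long_progressions κ fun n => c (2 ^ n)
  refine ⟨k₀, fun l => ?_⟩
  obtain ⟨a, d, hd, hmono⟩ := hk₀ l
  refine ⟨2 ^ a, 2 ^ d, Nat.two_pow_pos a, ?_, fun i hi => ?_⟩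
  · calc 2 = 2 ^ 1 := rfl
      _ ≤ 2 ^ d := Nat.pow_le_pow_right (by norm_num) hd
  · have h := hmono i hi
    have h' : c (2 ^ (a + i * d)) = k₀ := h
    rw [← h', pow_add, ← pow_mul, mul_comm d i]

end Literature.Combinatorics.Words
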